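import Summits.QuantumFields.YangMills.Theorems.UnitScaleTiltProp7SymAvgTwDefs
import Summits.QuantumFields.YangMills.Theorems.UnitScaleTiltProp7SymAvgGLSmallOfRegPr
import Summits.QuantumFields.YangMills.Theorems.UnitScaleTiltProp7AxialReprPrint
import Literature.MathematicalPhysics.QuantumFieldTheory.Balaban1983to89.B7Prop6GeneralAnalytic
import Literature.MathematicalPhysics.QuantumFieldTheory.Balaban1983to89.B7AvgClosedSpecialUnitarySharp
import HarnessLib

/-!
# `UnitScaleTiltProp7SymAvgTwFrameDiff` — THE DISPLAYED ROW `hr` OF THE Σ-TWIST BRIDGES, DISCHARGED FROM `RegPr`: the accumulated comb frame `A ↦ frameTw U₀ A y = \overline{R_{0,y}e^{A}}^{(k)}`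
# of the twisted chart of record IS lit-balaban's accumulated frame `vcov` ([Balaban1985Averaging] (97)–(99), `B7Eq99Concrete.wrec_eq_vcov`) at the pulled-back exponent, hence — by
# lit-balaban r04's `B7Prop6GeneralAnalytic.analyticAt_vcovQ` (Prop. 6's analyticity clause at a general background) on the (44)-window, which is OPEN at `A = 0` — **ANALYTIC AT `A = 0`** at
# every printed-regular background; so `r y := fderiv (A ↦ frameTw U₀ A y) 0` exists: the hypothesis `hr` of `Prop7SymAvgTwBridge` ∕ `…RightInverse` ∕ `…GaugeDir`
# (route `UnitScaleTilt`, crux K1 «MinimiserStabilityRegPr» stmt-QuantumFields-19200, stub `stub_existenceMinimalOrbit` (EX), route (α), (AVG-SYM); OWNER RULING g26-№1 Σ-TWIST (T), item (3c);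
# def-free, count-neutral)

Cell `ym3-torus` (HUMAN RULING D-0037, YM ladder rung R3 — YM₃ on T³ is a rung, not d = 4, not a mass gap, not Clay), width seat `ym-ust-20520-w5` (gen 3).

THE PRINT.  [Balaban1985Averaging] p. 42: «Proposition 4 implies that the functions of A in (159) are analytic functions …»; (97) p. 32 (the accumulated frames `v_j`), (99) `\overline{R_{0,x}U₁^{(j)}} = v_j(x)`;
Prop. 4 p. 38 (the windows (131): `α₀, α₁ ≦ c₄`).  [Balaban1985RegularSpaces] (1.139) p. 100 (`pdev U₀ < α₀L^{−2k}` — at T³ from `RegPr`, `Prop7AxialReprPrint.inAk_pull_of_regPr` ∕ `pdev_pull_lt`).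

WHAT IS PROVED (sorry-free, no definition; windows DISPLAYED numerically at `α₀ = 2ε₀`: `C₀(d)·2ε₀ ≤ ⅓`, `4·2ε₀ ≤ c₂′(d, L)`, `exp(3200(d+1)²(d+4)·2ε₀) < 2` — all implied by the knit's
`10⁷L³ε₀ ≤ 1`-type smallness, as in ★w2-19200's `Prop7ChartWindows`):
* §1 `pull_expUnit_eq_expCfg`, ★`frameTw_eq_vcov` (`frameTw U₀ A y = vcov L (U₀♯) (expCfg A♯) (K − n) (coordT3 y)`).
* §2 `norm_pullExp_le`, **`eventually_window`** (the (44)-window `e^{cα₀}(1 + 8C₁Lᵏ‖A‖) ≤ 2 ∧ 2Lᵏ‖A‖ ≤ c₃` holds for `A` near `0` when `e^{cα₀} < 2`).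
* §3 ★★★**`analyticAt_frameTw_zero_of_regPr`** — `AnalyticAt ℂ (A ↦ frameTw U₀ A y) 0`; ★★**`hasFDerivAt_frameTw_of_regPr`** — `∀ y, HasFDerivAt (A ↦ frameTw U₀ A y) (fderiv … 0) 0` (= `hr`).
HONEST FRAMING.  Plumbing over lit-balaban's kernel theorems and the T³ readings of `RegPr`; no explicit formula or bound for `r` (the sup row `‖rX‖ ≲ d·L^{K−n}‖X‖` is NOT here); nothing of print is
asserted.  `--supports stmt-QuantumFields-19200 --as helper`.

References: T. Bałaban, CMP 98 (1985) 17–51 [Balaban1985Averaging] ((8) p.19, (82) p.30, (97)–(99) p.32, Prop. 4 (130)–(135) p.38, p.42); CMP 99 (1985) 75–102 [Balaban1985RegularSpaces] ((1.3) p.77,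
(1.139) p.100); CMP 102 (1985) 277–309 [Balaban1985Variational] ((6) p.278).
-/

set_option autoImplicit false

noncomputable section

open scoped Matrix.Norms.L2Operator Topology

namespace Summit.QuantumFields.YangMills.Theorems.Prop7SymAvgTwFrameDiff

open NormedSpace Metric Set Filter
open Literature.MathematicalPhysics.QuantumFieldTheory.Balaban1983to89
open Literature.MathematicalPhysics.QuantumFieldTheory.Balaban1983to89.T3ContinuumYM3Torus
open T3PrintedRegularMinimiser (RegPr)
open T3LevelShift (siteShift)
open T3PrintedRegularOrbits (sites_eq)
open T3SectALandauChart (bgUnits)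
open B7Prop1Explicit renaming Site → LSite
open B7Prop1Explicit (expUnit val_expUnit)
open B7Prop2Explicit (pdev C0 c2' AvgClosed)
open B7Prop2SpecialUnitary (specialUnitaryUnits)
open B7Prop3Flat (expCfg c3 c3_nonneg)
open B7Eq99Concrete (wrec wrec_eq_vcov)
open B7Eq92Concrete (vcov)
open B7Eq123General (dbavgCovIter_eq_expCfg_logCovIter)
open B7Prop6GeneralAnalytic (vcovQ vcov_eq_vcovQ analyticAt_vcovQ)
open B7AvgClosedSpecialUnitarySharp (avgClosed_specialUnitary_of_le_twentyone)
open B10Eq27TorusAxialLog (pull pull_apply transl unitsField toUField)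
open Summit.QuantumFields.YangMills.Theorems.Prop7SPrint (basePt)
open Summit.QuantumFields.YangMills.Theorems.Prop7AxialReprPrint (pull_toUField_mem inAk_pull_of_regPr pdev_pull_lt)
open Summit.QuantumFields.YangMills.Theorems.Prop7SymAvgGLSmallOfRegPr (bgUnits_eq)
open Summit.QuantumFields.YangMills.Theorems.Prop7SymAvgTw (coordT3 frameTw)

variable (F : T3Family) {n K : ℕ} (h : n ≤ K)

/-! ## §1 The frame of `e^{A}` is lit-balaban's accumulated frame `vcov` at the pulled-back exponent -/

/-- `(e^{A})♯ = expCfg(A♯)` with `A♯ z κ := A(x₀ + z, κ)` (both are `expUnit` bondwise). [cite: Balaban1985Averaging, (8) p.19; Balaban1985RegularSpaces, (1.3) p.77] -/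
theorem pull_expUnit_eq_expCfg (A : PBond (F.P K) 0 → Matrix (Fin 2) (Fin 2) ℂ) (x₀ : Site (F.P K) 0) :
    pull (fun b => expUnit (A b)) x₀ = expCfg (fun z κ => A ⟨transl x₀ z, κ⟩) := by
  funext z κ; rfl

/-- ★ **`frameTw U₀ A y = vcov L (U₀♯) (expCfg A♯) (K − n) (coordT3 y)`** — the frame of the twisted chart IS lit-balaban's accumulated frame (97) `vcov` (`B7Eq99Concrete.wrec_eq_vcov`:
(99) `\overline{R_{0,·}U₁^{(j)}} = v_j`). [cite: Balaban1985Averaging, (97)–(99) p.32] -/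
theorem frameTw_eq_vcov (U₀ : GaugeField (F.P K) 0 (Matrix.specialUnitaryGroup (Fin 2) ℂ)) (A : PBond (F.P K) 0 → Matrix (Fin 2) (Fin 2) ℂ) (y : Site (F.P n) 0) :
    frameTw F n K h U₀ A y
      = vcov (F.P K).L (pull (bgUnits F K U₀) (basePt F n K)) (expCfg (fun z κ => A ⟨transl (basePt F n K) z, κ⟩)) (K - n) (coordT3 F n K h y) := by
  rw [Prop7SymAvgTw.frameTw_def, wrec_eq_vcov, pull_expUnit_eq_expCfg]

/-! ## §2 The Prop.-4 window near `A = 0`, and `vcov = vcovQ` there -/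

/-- The pulled-back exponent is bounded by the sup norm of `A`: `‖A♯ z κ‖ ≤ ‖A‖`. [folklore] -/
theorem norm_pullExp_le (A : PBond (F.P K) 0 → Matrix (Fin 2) (Fin 2) ℂ) (x₀ : Site (F.P K) 0) (z : LSite (F.P K).d) (κ : Fin (F.P K).d) :
    ‖A ⟨transl x₀ z, κ⟩‖ ≤ ‖A‖ :=
  norm_le_pi_norm A _

/-- **THE (44)-WINDOW IS OPEN AT `A = 0`**: if `e^{c·α₀} < 2` then for `A` in a neighbourhood of `0` the two Prop.-4 conditions of [Balaban1985Averaging] at `b := ‖A‖` hold: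
`e^{cα₀}(1 + 8C₁Lᵏ‖A‖) ≤ 2` and `2Lᵏ‖A‖ ≤ c₃`. [cite: Balaban1985Averaging, Prop. 4 p.38, (131) p.38] -/
theorem eventually_window {d L k : ℕ} {α₀ : ℝ} (hL : 1 ≤ L)
    (hexp : Real.exp (4 * (800 * ((d : ℝ) + 1) ^ 2 * ((d : ℝ) + 4)) * α₀) < 2) :
    ∀ᶠ A : PBond (F.P K) 0 → Matrix (Fin 2) (Fin 2) ℂ in 𝓝 0,
      Real.exp (4 * (800 * ((d : ℝ) + 1) ^ 2 * ((d : ℝ) + 4)) * α₀) * (1 + 8 * (131072 * ((d : ℝ) + 1) ^ 2) * ((L : ℝ) ^ k * ‖A‖)) ≤ 2 ∧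
        2 * ((L : ℝ) ^ k * ‖A‖) ≤ c3 d L := by
  set E : ℝ := Real.exp (4 * (800 * ((d : ℝ) + 1) ^ 2 * ((d : ℝ) + 4)) * α₀) with hE
  set C : ℝ := 8 * (131072 * ((d : ℝ) + 1) ^ 2) * (L : ℝ) ^ k with hC
  have hE0 : 0 < E := Real.exp_pos _
  have hC0 : 0 < C := by positivity
  have hLk : 0 < (L : ℝ) ^ k := by positivity
  have hc3 : 0 < c3 d L := B7Prop3Flat.c3_pos d hL
  -- radii
  set δ₁ : ℝ := (2 - E) / (E * C) with hδ₁
  set δ₂ : ℝ := c3 d L / (2 * (L : ℝ) ^ k) with hδ₂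
  have hδ₁0 : 0 < δ₁ := by rw [hδ₁]; exact div_pos (by linarith) (by positivity)
  have hδ₂0 : 0 < δ₂ := by rw [hδ₂]; positivity
  have hball : Metric.ball (0 : PBond (F.P K) 0 → Matrix (Fin 2) (Fin 2) ℂ) (min δ₁ δ₂) ∈ 𝓝 (0 : PBond (F.P K) 0 → Matrix (Fin 2) (Fin 2) ℂ) :=
    Metric.ball_mem_nhds 0 (lt_min hδ₁0 hδ₂0)
  filter_upwards [hball] with A hA
  rw [Metric.mem_ball, dist_zero_right] at hA
  have hA1 : ‖A‖ ≤ δ₁ := (hA.trans_le (min_le_left _ _)).le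
  have hA2 : ‖A‖ ≤ δ₂ := (hA.trans_le (min_le_right _ _)).le
  constructor
  · -- `E(1 + C‖A‖) ≤ E(1 + Cδ₁) = E + (2 − E) = 2`
    have h1 : E * (1 + C * ‖A‖) ≤ E * (1 + C * δ₁) := by
      apply mul_le_mul_of_nonneg_left _ hE0.le
      exact add_le_add le_rfl (mul_le_mul_of_nonneg_left hA1 hC0.le)
    have h2 : E * (1 + C * δ₁) = 2 := by
      rw [hδ₁]; field_simp; ring
    calc E * (1 + 8 * (131072 * ((d : ℝ) + 1) ^ 2) * ((L : ℝ) ^ k * ‖A‖)) = E * (1 + C * ‖A‖) := by rw [hC]; ring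
      _ ≤ 2 := h1.trans h2.le
  · have h1 : 2 * ((L : ℝ) ^ k * ‖A‖) ≤ 2 * ((L : ℝ) ^ k * δ₂) := by
      apply mul_le_mul_of_nonneg_left (mul_le_mul_of_nonneg_left hA2 hLk.le) (by norm_num)
    have h2 : 2 * ((L : ℝ) ^ k * δ₂) = c3 d L := by rw [hδ₂]; field_simp
    exact h1.trans h2.le

/-! ## §3 ★ THE FRAMES ARE ANALYTIC AT `A = 0` — the row `hr`, discharged -/

/-- ★★★ **`A ↦ frameTw U₀ A y` IS ANALYTIC AT `0` AT A PRINTED-REGULAR BACKGROUND** (lit-balaban r04's `B7Prop6GeneralAnalytic.analyticAt_vcovQ` — analyticity of the accumulated comb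
frames (97) in a bondwise-analytic exponent, here the linear pullback `A ↦ A♯` — under [Balaban1985Averaging] Prop. 2∕4's windows READ FROM `RegPr`: (1.139) `pdev U₀♯ < 2ε₀L^{−2k}`
(`Prop7AxialReprPrint.pdev_pull_lt ∘ inAk_pull_of_regPr`), `SU(2)`-valuedness (`pull_toUField_mem`, `avgClosed_specialUnitary_of_le_twentyone`), and the numeric windows at `α₀ = 2ε₀`
DISPLAYED (`C₀(d)·2ε₀ ≤ ⅓`, `4·2ε₀ ≤ c₂′(d,L)`, `e^{c(d)·2ε₀} < 2`); near `0` the frame IS `vcovQ` (`vcov_eq_vcovQ` on the (44)-window of §2)).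
[cite: Balaban1985Averaging, Prop. 4 p.38, (97)–(99) p.32, p.42; Balaban1985RegularSpaces, (1.139) p.100] -/
theorem analyticAt_frameTw_zero_of_regPr {ε₀ : ℝ} (hε₀ : 0 < ε₀)
    (hα3 : C0 (F.P K).d * (2 * ε₀) ≤ 1 / 3) (hα4 : 4 * (2 * ε₀) ≤ c2' (F.P K).d (F.P K).L)
    (hexp : Real.exp (4 * (800 * (((F.P K).d : ℝ) + 1) ^ 2 * (((F.P K).d : ℝ) + 4)) * (2 * ε₀)) < 2)
    (U₀ : GaugeField (F.P K) 0 (Matrix.specialUnitaryGroup (Fin 2) ℂ)) (hreg : RegPr F n K ε₀ U₀) (y : Site (F.P n) 0) :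
    AnalyticAt ℂ (fun A : PBond (F.P K) 0 → Matrix (Fin 2) (Fin 2) ℂ => ((frameTw F n K h U₀ A y : (Matrix (Fin 2) (Fin 2) ℂ)ˣ) : Matrix (Fin 2) (Fin 2) ℂ)) 0 := by
  have hL2 : 2 ≤ (F.P K).L := (F.P K).hL.2
  have hL1 : 1 ≤ (F.P K).L := le_trans (by norm_num) hL2
  have hd : (F.P K).d = 3 := T3Family.P_d F K
  -- the tower data read from `RegPr`
  have hU₀ : ∀ z κ, pull (bgUnits F K U₀) (basePt F n K) z κ ∈ specialUnitaryUnits (Fin 2) := fun z κ => by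
    rw [bgUnits_eq]; exact pull_toUField_mem U₀ _ z κ
  have hG := avgClosed_specialUnitary_of_le_twentyone (N := 2) (by norm_num) (F.P K).d (F.P K).L
  have h52 : pdev (pull (bgUnits F K U₀) (basePt F n K)) < 2 * ε₀ * ((((F.P K).L : ℝ) ^ (K - n))⁻¹) ^ 2 := by
    rw [bgUnits_eq]; exact pdev_pull_lt (P := F.P K) hε₀ (inAk_pull_of_regPr F (n := n) (K := K) hε₀.le hreg) (basePt F n K)
  have hα : 0 < 2 * ε₀ := by positivity
  -- the analytic exponent family `A ↦ A♯`
  set B : (PBond (F.P K) 0 → Matrix (Fin 2) (Fin 2) ℂ) → LSite (F.P K).d → Fin (F.P K).d → Matrix (Fin 2) (Fin 2) ℂ :=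
    fun A z κ => A ⟨transl (basePt F n K) z, κ⟩ with hB
  have hBa : ∀ z κ, AnalyticAt ℂ (fun A : PBond (F.P K) 0 → Matrix (Fin 2) (Fin 2) ℂ => B A z κ) 0 := fun z κ =>
    (ContinuousLinearMap.proj (R := ℂ) (φ := fun _ : PBond (F.P K) 0 => Matrix (Fin 2) (Fin 2) ℂ) (⟨transl (basePt F n K) z, κ⟩ : PBond (F.P K) 0)).analyticAt 0
  have hB0 : ∀ z κ, ‖B 0 z κ‖ ≤ 0 := fun z κ => by rw [hB]; simp
  have hsmall0 : Real.exp (4 * (800 * (((F.P K).d : ℝ) + 1) ^ 2 * (((F.P K).d : ℝ) + 4)) * (2 * ε₀))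
      * (1 + 8 * (131072 * (((F.P K).d : ℝ) + 1) ^ 2) * (((F.P K).L : ℝ) ^ (K - n) * 0)) ≤ 2 := by
    rw [mul_zero, mul_zero, add_zero, mul_one]; exact hexp.le
  have hc₃0 : 2 * ((((F.P K).L : ℝ)) ^ (K - n) * 0) ≤ c3 (F.P K).d (F.P K).L := by
    rw [mul_zero, mul_zero]; exact c3_nonneg _ _
  have κ₀ : Fin (F.P K).d := Fin.cast hd.symm 0
  -- lit-balaban: the accumulated frames `vcovQ` are analytic in `A` at `0`
  have hvQ := (analyticAt_vcovQ (E := PBond (F.P K) 0 → Matrix (Fin 2) (Fin 2) ℂ) (F.P K).L hL2 hG (K - n) (pull (bgUnits F K U₀) (basePt F n K)) hU₀ hα hα3 hα4 h52 B hBa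
    le_rfl hB0 hsmall0 hc₃0 κ₀ (K - n) le_rfl (coordT3 F n K h y)).1
  -- near `0`, `frameTw = vcovQ ∘ ♯`
  have hev : (fun A : PBond (F.P K) 0 → Matrix (Fin 2) (Fin 2) ℂ =>
        ((vcovQ (F.P K).L (pull (bgUnits F K U₀) (basePt F n K)) (B A) (K - n) (coordT3 F n K h y) : (Matrix (Fin 2) (Fin 2) ℂ)ˣ) : Matrix (Fin 2) (Fin 2) ℂ))
      =ᶠ[𝓝 0] fun A => ((frameTw F n K h U₀ A y : (Matrix (Fin 2) (Fin 2) ℂ)ˣ) : Matrix (Fin 2) (Fin 2) ℂ) := by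
    filter_upwards [eventually_window F (d := (F.P K).d) (L := (F.P K).L) (k := K - n) hL1 hexp] with A hA
    have hQ := dbavgCovIter_eq_expCfg_logCovIter (F.P K).L hL2 hG (K - n) (pull (bgUnits F K U₀) (basePt F n K)) hU₀ hα hα3 hα4 h52 (B A)
      (norm_nonneg A) (fun z κ => norm_pullExp_le F A (basePt F n K) z κ) hA.1 hA.2
    rw [frameTw_eq_vcov, vcov_eq_vcovQ (F.P K).L _ (B A) (K - n) hQ (K - n) le_rfl]
  exact hvQ.congr hev

/-- ★★ **THE ROW `hr` OF THE Σ-TWIST BRIDGES, DISCHARGED**: at a printed-regular background (windows as above) every frame `A ↦ frameTw U₀ A y` has a Fréchet derivative at `0`,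
`r y := fderiv ℂ (A ↦ frameTw U₀ A y) 0`. [cite: Balaban1985Averaging, (97) p.32, Prop. 4 p.38] -/
theorem hasFDerivAt_frameTw_of_regPr {ε₀ : ℝ} (hε₀ : 0 < ε₀)
    (hα3 : C0 (F.P K).d * (2 * ε₀) ≤ 1 / 3) (hα4 : 4 * (2 * ε₀) ≤ c2' (F.P K).d (F.P K).L)
    (hexp : Real.exp (4 * (800 * (((F.P K).d : ℝ) + 1) ^ 2 * (((F.P K).d : ℝ) + 4)) * (2 * ε₀)) < 2)
    (U₀ : GaugeField (F.P K) 0 (Matrix.specialUnitaryGroup (Fin 2) ℂ)) (hreg : RegPr F n K ε₀ U₀) :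
    ∀ y : Site (F.P n) 0, HasFDerivAt (fun A : PBond (F.P K) 0 → Matrix (Fin 2) (Fin 2) ℂ => ((frameTw F n K h U₀ A y : (Matrix (Fin 2) (Fin 2) ℂ)ˣ) : Matrix (Fin 2) (Fin 2) ℂ))
      (fderiv ℂ (fun A : PBond (F.P K) 0 → Matrix (Fin 2) (Fin 2) ℂ => ((frameTw F n K h U₀ A y : (Matrix (Fin 2) (Fin 2) ℂ)ˣ) : Matrix (Fin 2) (Fin 2) ℂ)) 0) 0 :=
  fun y => (analyticAt_frameTw_zero_of_regPr F h hε₀ hα3 hα4 hexp U₀ hreg y).differentiableAt.hasFDerivAt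

end Summit.QuantumFields.YangMills.Theorems.Prop7SymAvgTwFrameDiff

end
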